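import Mathlib
import HarnessLib
import HarnessLib.Audit
import Summits.Schanuel.Statement
import HarnessLib.Audit.Status.Attr

/-!
Route: CapacityLadder

DORMANT since 2026-08-23T12:33:45Z (reconciler: no traction for 6.1 d (last activity item-evidence-added at 2026-08-17T10:06:06Z); parked, not closed — `ledger route dormant route-Schanuel-CapacityLadder --off` to reactivate) — unstaffed, not closed; items shared with open routes are served there. `ledger route dormant <id> --off` reactivates.

# Route CapacityLadder — Schanuel past the n/2 grid-capacity cap on its two extremal families —
number-field lines of any slope and the e-power progression

LADDER ROUTE realising card grid-capacity-half-schanuel (gen-2; the gen-1 route GridCapacity was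
retired not-a-thesis because its
assembly stopped at the calibration). It suffices to show X = CartesianSchanuelThesis, the grid form
of Schanuel (SHARED verbatim with
route AlgIndepMethod): for x ∈ ℂ^d, y ∈ ℂ^ℓ with the dℓ products xᵢyⱼ ℚ-linearly independent, trdeg
ℚ(x, y, e^{xᵢyⱼ}) ≥ dℓ; the column
d = 1, x = (1) IS Schanuel (deciding theorem `closes`, kernel-checked) and Schanuel ⇒ X, so X ⟺
Schanuel. This route is the ALTERNATIVE
decomposition of X organised by the card's invariant, the GRID CAPACITY g(L) = max dℓ/(d+ℓ) over
grids X·Y ⊆ L = span_ℚ(z) — the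
quantity every theorem and conjecture of the several-variables Gel'fond–Schneider class delivers on
the tuple z. The provable-now supports
calibrate the class (g ≤ n/2 on every span, = n/2 exactly on number-field lines c·K, ≤ (N+2)/4 on
power progressions, ≤ (n+h(L))/4 by
linear Kneser) and land its positive half (⌈h/2⌉ of Schanuel on EVERY number-field line, any slope
c, via Diaz + Liouville); the three
ranked cruxes are Schanuel at full strength on exactly the families where the calibration says the
class stops at one half resp. one
quarter: number-field lines of arbitrary slope (rank 2), quadratic lines — two of c, e^c, e^{βc}
(rank 3), and the e-power progression
e, e^e, e^{e²}, … (rank 4). Each crux is a consequence of X (support LadderBookkeeping), not a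
factor of it.
Lean: `∀ (d l : ℕ) (x : Fin d → ℂ) (y : Fin l → ℂ), LinearIndependent ℚ (fun p : Fin d × Fin l => x
p.1 * y p.2) → ((d * l : ℕ) : Cardinal) ≤ Algebra.trdeg ℚ ↥(IntermediateField.adjoin ℚ (Set.range x
∪ Set.range y ∪ Set.range (fun p : Fin d × Fin l => Complex.exp (x p.1 * y p.2))))`

## Assembly
Bookkeeping only, and already DONE where it counts: the deciding theorem `closes (hX :
CartesianSchanuelThesis) : Schanuel` (glue.lean,
sorry-free, axioms propext / Classical.choice / Quot.sound, checked in Sketch.lean) specialises X at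
d = 1, x = ![1]: the products

Rationale: WHY THIS LINE. Mechanism (card grid-capacity-half-schanuel, audited new-combination): a grid X (d
elements), Y (ℓ elements) with X·Y ⊆ L = span_ℚ(z) is
exactly the data on which the class speaks about ℚ(z, e^z) — its outputs are t₂ ≥ 2 iff dℓ > d+ℓ
(NesterenkoPhilippon2001 Ch.14 Thm 2.9,
p.249), ⌈dℓ/(d+ℓ)⌉ under the Technical Hypothesis (Diaz1989 = Thm 2.7, p.248) and conjecturally
⌊dℓ/(d+ℓ)⌋+1 (Conj. 2.3, p.247) — and two
index sets sharing one n-dimensional span force d, ℓ ≤ n, so the class certifies at most n/2 of the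
n Schanuel asks for (AM–GM), with
equality only when the ratios yⱼ/y₀ are n independent multipliers of L, i.e. L = c·K is a line over
a number field K of degree n; on
power progressions span(1, θ, …, θ^N) the sumset bound d + ℓ ≤ N + 2 caps it at a quarter
(Chudnovsky1984 p.22: 3 of e,…,e^{e⁷}, 4 of
e,…,e^{e¹¹} are ⌈9/4⌉, ⌈13/4⌉), and linear Kneser for field extensions (HouLeungXiang2002,
BachocSerraZemor2018Kneser) interpolates:
d + ℓ ≤ n + h(L). Imported area: additive combinatorics of ℚ-subspaces of ℂ (product set ↔ sumset,
multiplier field ↔ period,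
Cauchy–Davenport ↔ the quarter, Kneser ↔ the stability statement), pointed at transcendence grids
for the first time (searched, § Novelty);
the printed shadow of the doubling is NesterenkoPhilippon2001 Ch.14 Thm 3.1 + Remark (p.250: one
variable gives d/4 − 1/2, redundant
variables d/2 − 1, for ℚ(α, α^β, …, α^{β^{d−1}}) with α > 0 ARBITRARY real — half of Schanuel on
every real number-field line, T.H.-free).
What it does that other routes do not: AlgIndepMethod staffs the slope c = log α column (log α ⊥
α^β; Gel'fond's ladder α^β,…,α^{β^{d−1}})
and T.H.-removal on general grids; DilateIntersection staffs density statements for exponential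
points of trdeg-1 fields; this route
staffs the two capacity-extremal FAMILIES at arbitrary slope — the quadratic-line crux is one
statement through Chudnovsky's Problem P1
(c = log α), Nesterenko's theorem (c ∈ π·ℚ(i)^×, known) and Schneider's e^e circle (c = e) — and
lands the calibration + the unconditional
half on lines as kernel-checked supports (the barrier LargeTranscendenceDegree measured per tuple).
Negatives index: empty (0 refuted).

RANKED CRUXES. #0 CartesianSchanuelThesis (target) — X — for x ∈ ℂ^d, y ∈ ℂ^ℓ with the dℓ products
xᵢyⱼ ℚ-linearly independent, trdeg_ℚ ℚ(x, y, e^{xᵢyⱼ}) ≥ dℓ; shared verbatim with route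
AlgIndepMethod (same decl name); d = 1, x = (1) is Schanuel. (why it might fail: X ⟺ Schanuel, so it
fails iff the summit does (an algebraic relation between e and π refutes it); and on a d×ℓ grid the
class reaches only ≈ dℓ/(d+ℓ) ≤ n/2 of the dℓ asked (CapacityLeHalf), even conjecturally (Conj.
2.3).) [NesterenkoPhilippon2001, Diaz1989, Chudnovsky1984, arXiv:math/0312440]
#2 SchanuelOnNumberFieldLines (crux) — SCHANUEL ON EVERY NUMBER-FIELD LINE, ANY SLOPE (card Theorem
A(ii) locus at full strength): for a ℚ-basis ω of a number field K of degree h (encoded: ω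
ℚ-linearly independent with span closed under products) and every c ≠ 0, trdeg_ℚ ℚ(cω, e^{cω}) ≥ h.
These lines c·K are exactly the spans of capacity n/2 (HalfOnlyOnNumberFieldLines); known: h for c
algebraic (Lindemann–Weierstrass, support AlgebraicSlopeLines), ⌈h/2⌉ for every c when h ≥ 3 (Diaz
Thm 2.7 with T.H. automatic, support HalfSchanuelOnLinesOfDiaz; real case T.H.-free in print:
NesterenkoPhilippon2001 Ch.14 Thm 3.1, d/2 − 1), Nesterenko's CM points; c = log α, K = ℚ(β) is
Gel'fond's 1948 ladder (AlgIndepMethod crux GelfondDiazLadderFull, implied by this one).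
[difficulty: open-problem] (why it might fail: False only with Schanuel; as a target it is exactly
TWICE the class's capacity on its own maximal locus — every proof since Gel'fond 1949 stops at ⌈h/2⌉
(Diaz1989; NP2001 p.249 '40 years later'), first open value h = 3 with c transcendental.)
[NesterenkoPhilippon2001, Diaz1989, Gelfond1949, Chudnovsky1984, arXiv:math/0312440]
#3 SchanuelOnQuadraticLines (crux) — TWO OF c, e^c, e^{βc} (the h = 2 rung, card's quadratic lines):
for β quadratic irrational (β ∉ ℚ, β² ∈ ℚ + ℚβ) and c ≠ 0, trdeg_ℚ ℚ(c, cβ, e^c, e^{cβ}) ≥ 2 =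
Schanuel n = 2 on the pair (c, cβ). One family through three classical points: c = log α is
Chudnovsky's Problem P1 (Chudnovsky1984 p.307; = AlgIndepMethod's LogAlphaAlphaBetaAlgIndep at
quadratic β, open even for (log 2, 2^√2)); c ∈ π·ℚ(i)^× with any β is KNOWN (Nesterenko1996: π ⊥
e^π); c = e, β = √2 contains Schneider's problem on e^e; c algebraic is Lindemann–Weierstrass. A 2×2
grid (cω, ω) has dℓ = d + ℓ, so not even Thm 2.9 or Conj. 2.3 says anything here: capacity exactly 1
of the 2 asked. [deps: SchanuelOnNumberFieldLines] [difficulty: open-problem] (why it might fail: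
False only with Schanuel n=2; unreachable by every grid criterion (2×2: dℓ = d+ℓ, below Thm 2.9's
entrance and outside Conj. 2.3's gain); the only proved transcendental-slope instances are modular
(Nesterenko1996), whose scope does not move off CM points.) [Chudnovsky1984, Nesterenko1996,
NesterenkoPhilippon2001, Gelfond1934, BakerTNT1975]
#4 ETowerAlgIndep (crux) — THE e-POWER PROGRESSION IS ALGEBRAICALLY INDEPENDENT (card Theorem C(a)
family at full strength): e, e^e, e^{e²}, e^{e³}, … are algebraically independent over ℚ, i.e.
Schanuel on (1, e, …, e^N) for every N. Known: one of e^e, e^{e²} is transcendental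
(Brownawell–Waldschmidt, BakerTNT1975 Thm 12.2, p.111); 2 independent among e, e^e, e^{e²}, e^{e³}
(Gel'fond–Tijdeman, Thm 2.9 on the 2×3 grid; Chudnovsky1984 p.152); 3 among the first 8 and 4 among
the first 12 (Chudnovsky1984 p.22); ⌈(N+2)/4⌉ in general under T.H. for powers of e (Diaz Thm 2.7) —
and by ProgressionQuarter no grid inside span(1, e, …, e^N) can certify more: the class stops at one
QUARTER here, the largest relative gap among the classical families. [difficulty: open-problem] (why
it might fail: False only with Schanuel; already 'e and e^e algebraically independent' (N = 1) is
open and even e^e ∉ ℚ̄ is (Schneider's 8th problem); grid input provably ends at (N+2)/4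
(ProgressionQuarter), so any proof needs non-product information.) [Chudnovsky1984, BakerTNT1975,
NesterenkoPhilippon2001, Diaz1989]
#9 CapacityLeHalf (support) — CAPACITY ≤ n/2 (card Theorem A(i)): any grid X (d), Y (ℓ), both
ℚ-linearly independent with all XᵢYⱼ in an n-dimensional span L = span_ℚ(x), has 2dℓ ≤ n(d+ℓ) (X ⊆
y⁻¹L gives d ≤ n once ℓ ≥ 1, symmetrically ℓ ≤ n). With Conj. 2.3's t₂-clause: the class's
conjectural completion certifies ≤ ⌊n/2⌋ + 1 on any n-tuple. [difficulty: provable-now]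
[NesterenkoPhilippon2001, Chudnovsky1984]
#9 HalfOnlyOnNumberFieldLines (support) — INVERSE THEOREM (card Theorem A(ii)): if a grid with d = ℓ
= n ≥ 1 sits inside L = span x (capacity exactly n/2) then L = c·K for an intermediate field K of
degree n: each yⱼ·span X = L, so the ratios yⱼ/y₀ are n independent multipliers of L; the multiplier
field {m : mL ⊆ L} has degree ≤ n, hence = n and L is a line over it. Certifies that crux 2's family
is the whole locus where the class gives one half. [difficulty: provable-now]
[NesterenkoPhilippon2001, Diaz1989]
#9 ProgressionQuarter (support) — QUARTER ON POWER PROGRESSIONS (card Theorem C(a), arbitrary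
non-monomial grids): for transcendental θ and L = span(1, θ, …, θ^N), every grid with d, ℓ ≥ 1
inside L has d + ℓ ≤ N + 2, so capacity ≤ (N+2)/4. Proof: normalise Y ∋ 1, so span X ⊆ ℚ[θ]_{≤N} and
span Y ⊂ ℚ(θ) ≅ ℚ(T); dimension = number of distinct degrees (valuations); top degrees add to ≤ N,
bottom ones to ≥ 0 (Cauchy–Davenport shape). False for θ algebraic of degree N+1 (then L is a
number-field line), hence the hypothesis. [difficulty: provable-now] [Chudnovsky1984,
BachocSerraZemor2017]
#9 KneserCapacityBound (support) — KNESER CEILING d + ℓ ≤ n + h(L) (the additive-combinatorics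
import in exact form; card C1 stability is its contrapositive): for ℚ-independent x ∈ ℂⁿ, L = span
x, h ≥ every degree of an intermediate field H with a line cH ⊆ L, and any grid X (d ≥ 1), Y (ℓ ≥ 1)
inside L: d + ℓ ≤ n + h. From linear Kneser for field extensions (HouLeungXiang2002 Thm;
BachocSerraZemor2018Kneser): dim UV ≥ dim U + dim V − [Stab(UV):ℚ] with U = span X, V = span Y, UV ⊆
L and Stab(UV)·w ⊆ L. Formalisation cost = linear Kneser (e-transform induction), not in Mathlib.
[difficulty: L] [HouLeungXiang2002, BachocSerraZemor2018Kneser, BachocSerraZemor2017]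
#9 NumberFieldBasisTH (support) — a ℚ-linearly independent family ω whose span is closed under
products (a basis of a number field of degree h) satisfies Waldschmidt's Technical Hypothesis
(NesterenkoPhilippon2001 Ch.14 Def. 2.6, p.248, inlined verbatim): |Σ kᵢωᵢ| ≥ exp(−H^ε) for H ≥
H₀(ε) — indeed ≥ C·H^{−(h−1)} by the norm (Liouville) inequality. The discharge that makes Diaz
unconditional on number-field lines; scaling by c ≠ 0 is free. [difficulty: provable-now]
[NesterenkoPhilippon2001, BakerTNT1975]
#9 HalfSchanuelOnLinesOfDiaz (support) — HALF OF SCHANUEL ON EVERY NUMBER-FIELD LINE (card S4; the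
positive half of crux 2, unconditional modulo the printed theorem): assuming Diaz's t₂-clause in the
printed form (hypothesis = NesterenkoPhilippon2001 Ch.14 Thm 2.7 with Def. 2.6 unfolded, = the third
conjunct of the named fact Literature.Barriers.Schanuel.diaz1989_largeTrdeg, inlined so the route
imports Mathlib only), for every ℚ-basis ω of a number field of degree h ≥ 3 and every c ≠ 0: ⌈h/2⌉
≤ trdeg ℚ(cω, e^{cω}). Proof: grid x = cω, y = ω (d = ℓ = h, dℓ > d + ℓ iff h ≥ 3), T.H. for both by
NumberFieldBasisTH, and ℚ(cω, ω, e^{cωᵢωⱼ}) is algebraic over ℚ(cω, e^{cω}) because ωᵢωⱼ ∈ span_ℚ ω.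
Real case printed T.H.-free as Thm 3.1 (p.250, d/2 − 1). [difficulty: M] [Diaz1989,
NesterenkoPhilippon2001, arXiv:math/0312440]
#9 AlgebraicSlopeLines (support) — KNOWN END OF CRUX 2: for algebraic slope c ≠ 0 the numbers cωᵢ
are algebraic and ℚ-linearly independent, so e^{cωᵢ} are algebraically independent by
Lindemann–Weierstrass (tree theorem
Literature.NumberTheory.Transcendental.linearIndependent_exp_holds / transcendental_exp_holds,
sorry-free) and trdeg ℚ(cω, e^{cω}) ≥ h. (ωᵢ is integral: multiplication by ωᵢ is an endomorphism of
the finite-dimensional span.) [difficulty: provable-now] [BakerTNT1975, NesterenkoPhilippon2001]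
#9 LadderBookkeeping (support) — THE LADDER IS BELOW X: X ⇒ SchanuelOnNumberFieldLines (column d =
1, x = (1), y = cω: cω is ℚ-independent for c ≠ 0), SchanuelOnNumberFieldLines ⇒
SchanuelOnQuadraticLines (h = 2, ω = (1, β)), X ⇒ ETowerAlgIndep (y = (1, e, …, e^N), ℚ-independent
by transcendence of e — tree theorem
Literature.NumberTheory.Transcendental.transcendental_exp_one_holds; algebraic independence of an
ℕ-family is that of its finite subfamilies). Certifies honestly that every crux is a consequence of
the target. [difficulty: provable-now] [NesterenkoPhilippon2001, BakerTNT1975]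

TWO-LAYER PLAN. Foreseen glued splits (none filed now; k ≤ 2, depth 1): SchanuelOnQuadraticLines ⇐
(e^c algebraic: Chudnovsky's P1, shared with
AlgIndepMethod's rung at quadratic β) → (e^c transcendental: the Schneider/e^e branch) →
SchanuelOnQuadraticLines, glue = case split on
IsAlgebraic ℚ (exp c); SchanuelOnNumberFieldLines ⇐ (h ≤ 2: the quadratic crux + Hermite–Lindemann)
→ (h ≥ 3: first target ⌈h/2⌉ + 1,
'one past Diaz', the cheapest detector of non-grid input on lines) → SchanuelOnNumberFieldLines;
ETowerAlgIndep ⇐ (N = 1: e ⊥ e^e) →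
(uniform 'beyond the quarter': trdeg ≥ ⌈(N+2)/4⌉ + 1 for all large N) → full. KneserCapacityBound ⇐
linear Kneser as a Literature theorem
(Literature/Combinatorics/Additive, requested when a prover claims it) → the ten-line deduction.

KILL CRITERIA. Every crux and the target are consequences of Schanuel (LadderBookkeeping; X ⟺
Schanuel): a refutation of CartesianSchanuelThesis,
SchanuelOnNumberFieldLines, SchanuelOnQuadraticLines or ETowerAlgIndep refutes the SUMMIT — close
`refuted:<Decl>` and hand the witness
(an algebraic relation on a number-field line or in the e-progression) to every Schanuel route. A
support refuted can only be a
mis-formalisation (coercions in HalfSchanuelOnLinesOfDiaz's inlined clause, the `0 < n` / `0 < d`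
guards, the span-closed encoding of a
number-field basis): restate once (new decl <Decl>R), else drop — none is load-bearing for `closes`.
A theorem that the class cannot pass
⌈h/2⌉ on lines without new input is not a kill but the calibration confirmed; the pivot then is to
the non-product engines (RoyCriterion /
PowerMapCalibration share the same X-level). Mooted: any route proving Schanuel; superseded if
AlgIndepMethod absorbs the arbitrary-slope
rungs and the calibration supports (then close `superseded --by route-Schanuel-AlgIndepMethod`,
shared items keep both routes).

NOT DECOMPOSED YET. Card Theorem B (Waldschmidt's several-parameter Conj. 2.4/2.5 also stop at n/2:
needs a Lean rendering of μ(Y, V) — the rank-projection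
count stays in the card); the exact extremal function g(L) through the multiplier spectrum m ↦
dim(mL ∩ L) (card C(c); the pair
U = V = ℚ(√2) ⊕ ℚθ shows g is not a function of h(L) alone); the inverse/stability theorem for
near-extremal grids beyond Kneser
(critical pairs of ℚ-subspaces of ℂ are unclassified, BachocSerraZemor2017 §1); the triage table
(capacity of every staffed Schanuel
tuple) — evidence for the barrier docstring, not an item; the general progression rung c·(1, θ, …,
θ^N) for arbitrary transcendental θ
(its N = 1 case is all of Schanuel n = 2 off algebraic ratios, hence deliberately NOT a crux — the
e-progression is the on-mechanism
slice); modular/elliptic grids (Nesterenko1996) as the known CM points of crux 3; quantitative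
versions. Prior-programme inspiration notes
not read (plancard mode).

CHEAPEST FALSIFIER. Logic/lookup, minutes each: (i) is the quadratic-line family already a named
open problem in print beyond c = log α (Chudnovsky1984 P1
p.307) — e.g. in Waldschmidt's surveys (arXiv:math/0312440 §3) as 'z, e^z, e^{βz}'? If yes crux 3 is
graded known-open (still a rung,
novelty of the ROUTE rests on the calibration supports + arbitrary slope); (ii) the inverse theorem
HalfOnlyOnNumberFieldLines against a
span with a full n×n grid and multiplier field ℚ — impossible by the three-line proof (checked by
hand: yⱼ/y₀ are n independent
multipliers); (iii) ProgressionQuarter against Chudnovsky's printed counts: ⌈(7+2)/4⌉ = 3,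
⌈(11+2)/4⌉ = 4 — match (checked); (iv) the
Bachoc–Serra–Zémor conic pair ⟨1, x, y⟩², x² + y² + 1 = 0 (n = 5, h = 1, d + ℓ = 6 = n + h) — sits
exactly on KneserCapacityBound, does
not break it (checked by the gen-1 planner). Sketch.lean (all 13 decls + `closes`) elaborates, rc 0,
this session.

NUMBERS. Class outputs on a d×ℓ grid: t₂ ≥ 2 iff dℓ > d+ℓ (Thm 2.9, T.H.-free); ⌈dℓ/(d+ℓ)⌉ under
T.H. (Thm 2.7); ⌊dℓ/(d+ℓ)⌋+1 conjectural
(Conj. 2.3); Schanuel dℓ. Capacity: n/2 on number-field lines (h(L) = n), (N+2)/4 on power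
progressions, (n+h(L))/4 in general (Kneser),
< 1 on spans with no 2×2 grid. Lines of degree h: known h (c algebraic, LW), ⌈h/2⌉ for all c (h ≥ 3,
Diaz), d/2 − 1 T.H.-free real case
(Thm 3.1) vs h wanted; one variable alone gives d/4 − 1/2 (Thm 3.1 Remark, p.250). Quadratic lines:
1 known (Gel'fond–Schneider /
Hermite–Lindemann) vs 2 wanted; known points c ∈ ℚ̄ (LW), c ∈ π·ℚ(i)^× (Nesterenko1996).
e-progression e, e^e, …, e^{e^N}: N = 2 one of
e^e, e^{e²} ∉ ℚ̄ (BakerTNT1975 Thm 12.2); N = 3: 2 (Chudnovsky1984 p.152); N = 7: 3, N = 11: 4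
(p.22); ⌈(N+2)/4⌉ under T.H.; Schanuel
N+1. Items at open: 13 (1 target, 3 cruxes, 8 support, 1 assembly).

DEFINITION REQUESTS. None: capacity, multiplier field, h(L), the Technical Hypothesis and Diaz's
t₂-clause are inlined (Mathlib-only signatures; no unproved
named fact enters the import cone). If a prover claims KneserCapacityBound, a Literature theorem
`linearKneser` (HouLeungXiang2002 Thm 1)
under Literature/Combinatorics/Additive is the natural request; Lindemann–Weierstrass and the
transcendence of e are already tree theorems.

Novelty: Searches (2026-08-15): this session — `lit read` NesterenkoPhilippon2001 pp.237, 247–252 (Conj.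
2.3–2.5, Def. 2.6, Thm 2.7, Cor. 2.8,
Thm 2.9, Thm 3.1 + Remark), Chudnovsky1984 pp.22, 152, 307 (Cor. 4 'half', tower counts, Problem 5,
Gel'fond's 2-of-4, P1/P2), BakerTNT1975
pp.110–112 (Thm 12.1–12.3); `lit search --hybrid "Brownawell Waldschmidt e^e e^{e^2} …" --source
local` (8 + 6 rows: Baker p.111, NP2001
p.237); `lean search` for Lindemann–Weierstrass / transcendence of e in tree (found, proved);
`ledger negatives --problem Schanuel` (0);
the 34 route files of the sub (status lines; AlgIndepMethod, DilateIntersection,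
PowerMapCalibration, GridCapacity read in full). Carried
from the card + its novelty audit + the gen-1 route: NP2001 pp.246–250 and Chudnovsky pp.22/64 page
reads, crossref/arXiv for linear
Kneser/Vosper (HouLeungXiang2002, BachocSerraZemor2017 arXiv:1501.00602 read pp.3, 9–10,
BachocSerraZemor2018Kneser), `lit frontier
Schanuel --since 2020`, `lit bridges Schanuel --cross any` (Zilber–Pink / o-minimal only); galaxyd
was saturated for both predecessors.
Nearest prior art found: NesterenkoPhilippon2001 Ch.14 (per-grid theorems/conjectures; Thm 3.1 =
half on real lines of any slope;
Cor. 2.8 = Gel'fond's ladder), Chudnovsky1984 p.22 ('half of Schanuel', tower counts) and p.307 P1,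
BakerTNT1975 Thm 12.2, linear Kneser
(HouLeungXiang2002) never pointed at transcendence grids, routes AlgIndepMethod (slope log α) and
DilateIntersection (density twin).
Delta: the pe  [refs: 1501.00602, NesterenkoPhilippon2001, Chudnovsky1984, BakerTNT1975, HouLeungXiang2002, BachocSerraZemor2017]

Barriers (technique_class: large-trdeg-grids, additive-combinatorics, capacity, ladder): - technique_class: large-trdeg-grids, additive-combinatorics, capacity, ladder
- Literature.Barriers.Schanuel.LargeTranscendenceDegree: it does not evade it — it MEASURES it: the
supports prove that this class, including its conjectural completion WaldschmidtConjecture_2_3,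
certifies at most ⌊(n+h(L))/4⌋ + 1 ≤ ⌊n/2⌋ + 1 on any n-tuple and exactly where the maximum sits;
the cruxes are by construction the statements just past that reach, so the bet is on non-product
input (derivations à la Roy, modular/CM structure, or new zero estimates), not on the grid method.
- Literature.Barriers.Schanuel.LinearSubgroupMethodLimit: same genre (Roy1995 Thm 3.4 is a d + ℓ ≤
4r count on 3-dimensional log spans); consistent — nothing here uses the linear subgroup theorem
beyond its printed reach.
- Literature.Barriers.Schanuel.AlgebraicIndependenceOfLogarithms: crux 3 at c = log α₁, β with
e^{cβ} = α₂ would touch logs only if β were a ratio of logarithms — excluded (β algebraic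
irrational, Gel'fond–Schneider); no claim on independence of logarithms is made.
- Literature.Barriers.Schanuel.NesterenkoModularScope: the known transcendental-slope points of crux
3 are exactly Nesterenko's CM points; the crux asks for all slopes, conceded to lie outside the
modular method's scope — recorded as the crux's why-it-might-fail, not evaded.
- Literature.Barriers.Schanuel.AxiomsDoNotForceSchanuel,
Literature.Barriers.Schanuel.SchanuelPropertyNotFirstOrder,
Literature.Barriers.Schanuel.AxSchanuelFunctionalN

Novelty grade: new-combination — ROUTE REVIEW (refuter rreview-0815T18-20): RESTATEMENT — recommend CLOSE as not-a-thesis / superseded-by route-Schanuel-AlgIndepMethod (shares X = stmt-0089), KEEPING the provable supports as Literature calibration targets. Reason: the deciding theorem `closes (hX : CartesianSchanuelThesis) : Schanu (refuter refuter-rreview-0815T18-20-0, 2026-08-15T19:45:40Z; prior: NesterenkoPhilippon2001 Ch.14 Thm 2.7/2.9/3.1 (read p.247-250), Diaz1989, Chudnovsky1984 p.22, p.307, HouLeungXiang2002 (linear Kneser), BachocSerraZemor2017 arXiv:1501.00602, BakerTNT1975 Thm 12.2)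

History (route lifecycle, newest last):
- 2026-08-16T02:19:14Z · AUTO-CRUX: 1 conjecture-grade item(s) promoted to crux (CartesianSchanuelThesis) — refuter vetting / tiering apply (operator:999:1362873)
- 2026-08-16T04:16:57Z · AUTO-CRUX (backfill): CartesianSchanuelThesis — hypotheses of the deciding theorem that nothing in the route derives are cruxes (operator:999:1085951)
- 2026-08-23T12:33:45Z · DORMANT — reconciler: no traction for 6.1 d (last activity item-evidence-added at 2026-08-17T10:06:06Z); parked, not closed — `ledger route dormant route-Schanuel-Capacit (operator:999:3315060)

sub-problem: Schanuel · status: dormant · opened planner-plancard-Schanuel-Schanuel-grid-capac-7f2e3e00-g2-0 2026-08-15T18:50:07Z · rev 1 · ledger route-Schanuel-CapacityLadder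
GENERATED by the gate from the ledger (D-0016/17). Provers cite these decls: `theorem foo : Summit.Schanuel.Schanuel.Theses.CapacityLadder.<Decl> := …` in Summits/Schanuel/Schanuel/Theorems/<Name>.lean.
-/

namespace Summit.Schanuel.Schanuel.Theses.CapacityLadder

open scoped BigOperators Topology Manifold Classical MeasureTheory ProbabilityTheory Matrix InnerProductSpace ComplexConjugate ContinuousMap
open Filter Set Function TopologicalSpace MeasureTheory

attribute [summit_statement] _root_.Schanuel

open Literature.Periods

/-- item stmt-Schanuel-0089 · crux (kind.auto-crux: conjecture-grade) · rank 0 · open · by planner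
why it might fail: X ⟺ Schanuel, so it fails iff the summit does (an algebraic relation between e and π refutes it); and on a d×ℓ grid the class reaches only ≈ dℓ/(d+ℓ) ≤ n/2 of the dℓ asked (CapacityLeHalf), even conjecturally (Conj. 2.3).
sources: NesterenkoPhilippon2001, Diaz1989, Chudnovsky1984, arXiv:math/0312440
Several-variables algebraic independence conjecture for exp on the (d,l) grid; d=1, x=(1) is
Schanuel and Schanuel ⇒ X (apply to the products). Unconditional frontier: trdeg ≥ ~dl/(d+l) under a
technical hypothesis (Waldschmidt2000 Ch. 12–15, Diaz1989, Philippon1986, Chudnovsky1976). Sources: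
Waldschmidt2000 §1.3–1.4 and Ch. 15, Diaz1989. -/
@[route_item "route-Schanuel-CapacityLadder", crux]
def CartesianSchanuelThesis : Prop :=
  ∀ (d l : ℕ) (x : Fin d → ℂ) (y : Fin l → ℂ), LinearIndependent ℚ (fun p : Fin d × Fin l => x p.1 * y p.2) → ((d * l : ℕ) : Cardinal) ≤ Algebra.trdeg ℚ ↥(IntermediateField.adjoin ℚ (Set.range x ∪ Set.range y ∪ Set.range (fun p : Fin d × Fin l => Complex.exp (x p.1 * y p.2))))

/-- item stmt-Schanuel-12134 · crux · rank 2 · open · by planner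
why it might fail: False only with Schanuel; as a target it is exactly TWICE the class's capacity on its own maximal locus — every proof since Gel'fond 1949 stops at ⌈h/2⌉ (Diaz1989; NP2001 p.249 '40 years later'), first open value h = 3 with c transcendental.
sources: NesterenkoPhilippon2001, Diaz1989, Gelfond1949, Chudnovsky1984, arXiv:math/0312440
[crux] SCHANUEL ON EVERY NUMBER-FIELD LINE, ANY SLOPE (card Theorem A(ii) locus at full strength):
for a ℚ-basis ω of a number field K of degree h (encoded: ω ℚ-linearly independent with span closed
under products) and every c ≠ 0, trdeg_ℚ ℚ(cω, e^{cω}) ≥ h. These lines c·K are exactly the spans of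
capacity n/2 (HalfOnlyOnNumberFieldLines); known: h for c algebraic (Lindemann–Weierstrass, support
AlgebraicSlopeLines), ⌈h/2⌉ for every c when h ≥ 3 (Diaz Thm 2.7 with T.H. automatic, support
HalfSchanuelOnLinesOfDiaz; real case T.H.-free in print: NesterenkoPhilippon2001 Ch.14 Thm 3.1, d/2
− 1), Nesterenko's CM points; c = log α, K = ℚ(β) is Gel'fond's 1948 ladder (AlgIndepMethod crux
GelfondDiazLadderFull, implied by this one). [difficulty: open-problem] -/
@[route_item "route-Schanuel-CapacityLadder"]
def SchanuelOnNumberFieldLines : Prop :=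
  ∀ (h : ℕ) (ω : Fin h → ℂ) (c : ℂ), LinearIndependent ℚ ω → (∀ i j, ω i * ω j ∈ Submodule.span ℚ (Set.range ω)) → c ≠ 0 → (h : Cardinal) ≤ Algebra.trdeg ℚ ↥(IntermediateField.adjoin ℚ (Set.range (fun i => c * ω i) ∪ Set.range (fun i => Complex.exp (c * ω i))))

/-- item stmt-Schanuel-12135 · crux · rank 3 · open · by planner
why it might fail: False only with Schanuel n=2; unreachable by every grid criterion (2×2: dℓ = d+ℓ, below Thm 2.9's entrance and outside Conj. 2.3's gain); the only proved transcendental-slope instances are modular (Nesterenko1996), whose scope does not move off CM points.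
sources: Chudnovsky1984, Nesterenko1996, NesterenkoPhilippon2001, Gelfond1934, BakerTNT1975
[crux] TWO OF c, e^c, e^{βc} (the h = 2 rung, card's quadratic lines): for β quadratic irrational (β
∉ ℚ, β² ∈ ℚ + ℚβ) and c ≠ 0, trdeg_ℚ ℚ(c, cβ, e^c, e^{cβ}) ≥ 2 = Schanuel n = 2 on the pair (c, cβ).
One family through three classical points: c = log α is Chudnovsky's Problem P1 (Chudnovsky1984
p.307; = AlgIndepMethod's LogAlphaAlphaBetaAlgIndep at quadratic β, open even for (log 2, 2^√2)); c
∈ π·ℚ(i)^× with any β is KNOWN (Nesterenko1996: π ⊥ e^π); c = e, β = √2 contains Schneider's problem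
on e^e; c algebraic is Lindemann–Weierstrass. A 2×2 grid (cω, ω) has dℓ = d + ℓ, so not even Thm 2.9
or Conj. 2.3 says anything here: capacity exactly 1 of the 2 asked. [deps:
SchanuelOnNumberFieldLines] [difficulty: open-problem] -/
@[route_item "route-Schanuel-CapacityLadder"]
def SchanuelOnQuadraticLines : Prop :=
  ∀ (β c : ℂ), β ∉ Set.range ((↑) : ℚ → ℂ) → β ^ 2 ∈ Submodule.span ℚ ({1, β} : Set ℂ) → c ≠ 0 → (2 : Cardinal) ≤ Algebra.trdeg ℚ ↥(IntermediateField.adjoin ℚ ({c, c * β, Complex.exp c, Complex.exp (c * β)} : Set ℂ))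

/-- item stmt-Schanuel-12136 · crux · rank 4 · open · by planner
why it might fail: False only with Schanuel; already 'e and e^e algebraically independent' (N = 1) is open and even e^e ∉ ℚ̄ is (Schneider's 8th problem); grid input provably ends at (N+2)/4 (ProgressionQuarter), so any proof needs non-product information.
sources: Chudnovsky1984, BakerTNT1975, NesterenkoPhilippon2001, Diaz1989
[crux] THE e-POWER PROGRESSION IS ALGEBRAICALLY INDEPENDENT (card Theorem C(a) family at full
strength): e, e^e, e^{e²}, e^{e³}, … are algebraically independent over ℚ, i.e. Schanuel on (1, e,
…, e^N) for every N. Known: one of e^e, e^{e²} is transcendental (Brownawell–Waldschmidt,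
BakerTNT1975 Thm 12.2, p.111); 2 independent among e, e^e, e^{e²}, e^{e³} (Gel'fond–Tijdeman, Thm
2.9 on the 2×3 grid; Chudnovsky1984 p.152); 3 among the first 8 and 4 among the first 12
(Chudnovsky1984 p.22); ⌈(N+2)/4⌉ in general under T.H. for powers of e (Diaz Thm 2.7) — and by
ProgressionQuarter no grid inside span(1, e, …, e^N) can certify more: the class stops at one
QUARTER here, the largest relative gap among the classical families. [difficulty: open-problem] -/
@[route_item "route-Schanuel-CapacityLadder"]
def ETowerAlgIndep : Prop :=
  AlgebraicIndependent ℚ (fun s : ℕ => Complex.exp (Complex.exp 1 ^ s))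

/-- item stmt-Schanuel-12137 · support · rank 9 · open · by planner
sources: NesterenkoPhilippon2001, Chudnovsky1984
[support] CAPACITY ≤ n/2 (card Theorem A(i)): any grid X (d), Y (ℓ), both ℚ-linearly independent
with all XᵢYⱼ in an n-dimensional span L = span_ℚ(x), has 2dℓ ≤ n(d+ℓ) (X ⊆ y⁻¹L gives d ≤ n once ℓ
≥ 1, symmetrically ℓ ≤ n). With Conj. 2.3's t₂-clause: the class's conjectural completion certifies
≤ ⌊n/2⌋ + 1 on any n-tuple. [difficulty: provable-now] -/
@[route_item "route-Schanuel-CapacityLadder"]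
def CapacityLeHalf : Prop :=
  ∀ (n : ℕ) (x : Fin n → ℂ), LinearIndependent ℚ x → ∀ (d l : ℕ) (X : Fin d → ℂ) (Y : Fin l → ℂ), LinearIndependent ℚ X → LinearIndependent ℚ Y → (∀ i j, X i * Y j ∈ Submodule.span ℚ (Set.range x)) → 2 * d * l ≤ n * (d + l)

/-- item stmt-Schanuel-12138 · support · rank 9 · open · by planner
sources: NesterenkoPhilippon2001, Diaz1989
[support] INVERSE THEOREM (card Theorem A(ii)): if a grid with d = ℓ = n ≥ 1 sits inside L = span x
(capacity exactly n/2) then L = c·K for an intermediate field K of degree n: each yⱼ·span X = L, so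
the ratios yⱼ/y₀ are n independent multipliers of L; the multiplier field {m : mL ⊆ L} has degree ≤
n, hence = n and L is a line over it. Certifies that crux 2's family is the whole locus where the
class gives one half. [difficulty: provable-now] -/
@[route_item "route-Schanuel-CapacityLadder"]
def HalfOnlyOnNumberFieldLines : Prop :=
  ∀ (n : ℕ) (x : Fin n → ℂ), LinearIndependent ℚ x → 0 < n → ∀ (X Y : Fin n → ℂ), LinearIndependent ℚ X → LinearIndependent ℚ Y → (∀ i j, X i * Y j ∈ Submodule.span ℚ (Set.range x)) → ∃ (K : IntermediateField ℚ ℂ) (c : ℂ), Module.finrank ℚ K = n ∧ ∀ z : ℂ, z ∈ Submodule.span ℚ (Set.range x) ↔ ∃ k ∈ K, z = c * k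

/-- item stmt-Schanuel-12139 · support · rank 9 · open · by planner
sources: Chudnovsky1984, BachocSerraZemor2017
[support] QUARTER ON POWER PROGRESSIONS (card Theorem C(a), arbitrary non-monomial grids): for
transcendental θ and L = span(1, θ, …, θ^N), every grid with d, ℓ ≥ 1 inside L has d + ℓ ≤ N + 2, so
capacity ≤ (N+2)/4. Proof: normalise Y ∋ 1, so span X ⊆ ℚ[θ]_{≤N} and span Y ⊂ ℚ(θ) ≅ ℚ(T);
dimension = number of distinct degrees (valuations); top degrees add to ≤ N, bottom ones to ≥ 0
(Cauchy–Davenport shape). False for θ algebraic of degree N+1 (then L is a number-field line), hence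
the hypothesis. [difficulty: provable-now] -/
@[route_item "route-Schanuel-CapacityLadder"]
def ProgressionQuarter : Prop :=
  ∀ (N : ℕ) (θ : ℂ), Transcendental ℚ θ → ∀ (d l : ℕ) (X : Fin d → ℂ) (Y : Fin l → ℂ), LinearIndependent ℚ X → LinearIndependent ℚ Y → (∀ i j, X i * Y j ∈ Submodule.span ℚ (Set.range fun s : Fin (N + 1) => θ ^ (s : ℕ))) → 0 < d → 0 < l → d + l ≤ N + 2

/-- item stmt-Schanuel-12140 · support · rank 9 · open · by planner
sources: HouLeungXiang2002, BachocSerraZemor2018Kneser, BachocSerraZemor2017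
[support] KNESER CEILING d + ℓ ≤ n + h(L) (the additive-combinatorics import in exact form; card C1
stability is its contrapositive): for ℚ-independent x ∈ ℂⁿ, L = span x, h ≥ every degree of an
intermediate field H with a line cH ⊆ L, and any grid X (d ≥ 1), Y (ℓ ≥ 1) inside L: d + ℓ ≤ n + h.
From linear Kneser for field extensions (HouLeungXiang2002 Thm; BachocSerraZemor2018Kneser): dim UV
≥ dim U + dim V − [Stab(UV):ℚ] with U = span X, V = span Y, UV ⊆ L and Stab(UV)·w ⊆ L. Formalisation
cost = linear Kneser (e-transform induction), not in Mathlib. [difficulty: L] -/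
@[route_item "route-Schanuel-CapacityLadder"]
def KneserCapacityBound : Prop :=
  ∀ (n : ℕ) (x : Fin n → ℂ), LinearIndependent ℚ x → ∀ (h : ℕ), (∀ (H : IntermediateField ℚ ℂ) (c : ℂ), c ≠ 0 → (∀ a ∈ H, c * a ∈ Submodule.span ℚ (Set.range x)) → Module.finrank ℚ H ≤ h) → ∀ (d l : ℕ) (X : Fin d → ℂ) (Y : Fin l → ℂ), LinearIndependent ℚ X → LinearIndependent ℚ Y → (∀ i j, X i * Y j ∈ Submodule.span ℚ (Set.range x)) → 0 < d → 0 < l → d + l ≤ n + h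

/-- item stmt-Schanuel-12141 · support · rank 9 · open · by planner
sources: NesterenkoPhilippon2001, BakerTNT1975
[support] a ℚ-linearly independent family ω whose span is closed under products (a basis of a number
field of degree h) satisfies Waldschmidt's Technical Hypothesis (NesterenkoPhilippon2001 Ch.14 Def.
2.6, p.248, inlined verbatim): |Σ kᵢωᵢ| ≥ exp(−H^ε) for H ≥ H₀(ε) — indeed ≥ C·H^{−(h−1)} by the
norm (Liouville) inequality. The discharge that makes Diaz unconditional on number-field lines;
scaling by c ≠ 0 is free. [difficulty: provable-now] -/
@[route_item "route-Schanuel-CapacityLadder"]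
def NumberFieldBasisTH : Prop :=
  ∀ (h : ℕ) (ω : Fin h → ℂ), LinearIndependent ℚ ω → (∀ i j, ω i * ω j ∈ Submodule.span ℚ (Set.range ω)) → ∀ ε : ℝ, 0 < ε → ∃ H₀ : ℝ, 0 < H₀ ∧ ∀ H : ℝ, H₀ ≤ H → ∀ k : Fin h → ℤ, k ≠ 0 → (∀ i, |(k i : ℝ)| ≤ H) → Real.exp (-(H ^ ε)) ≤ ‖∑ i, (k i : ℂ) * ω i‖

/-- item stmt-Schanuel-12142 · support · rank 9 · open · by planner
sources: Diaz1989, NesterenkoPhilippon2001, arXiv:math/0312440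
[support] HALF OF SCHANUEL ON EVERY NUMBER-FIELD LINE (card S4; the positive half of crux 2,
unconditional modulo the printed theorem): assuming Diaz's t₂-clause in the printed form (hypothesis
= NesterenkoPhilippon2001 Ch.14 Thm 2.7 with Def. 2.6 unfolded, = the third conjunct of the named
fact Literature.Barriers.Schanuel.diaz1989_largeTrdeg, inlined so the route imports Mathlib only),
for every ℚ-basis ω of a number field of degree h ≥ 3 and every c ≠ 0: ⌈h/2⌉ ≤ trdeg ℚ(cω, e^{cω}).
Proof: grid x = cω, y = ω (d = ℓ = h, dℓ > d + ℓ iff h ≥ 3), T.H. for both by NumberFieldBasisTH,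
and ℚ(cω, ω, e^{cωᵢωⱼ}) is algebraic over ℚ(cω, e^{cω}) because ωᵢωⱼ ∈ span_ℚ ω. Real case printed
T.H.-free as Thm 3.1 (p.250, d/2 − 1). [difficulty: M] -/
@[route_item "route-Schanuel-CapacityLadder"]
def HalfSchanuelOnLinesOfDiaz : Prop :=
  (∀ (d l : ℕ) (x : Fin d → ℂ) (y : Fin l → ℂ), LinearIndependent ℚ x → (∀ ε : ℝ, 0 < ε → ∃ H₀ : ℝ, 0 < H₀ ∧ ∀ H : ℝ, H₀ ≤ H → ∀ k : Fin d → ℤ, k ≠ 0 → (∀ i, |(k i : ℝ)| ≤ H) → Real.exp (-(H ^ ε)) ≤ ‖∑ i, (k i : ℂ) * x i‖) → LinearIndependent ℚ y → (∀ ε : ℝ, 0 < ε → ∃ H₀ : ℝ, 0 < H₀ ∧ ∀ H : ℝ, H₀ ≤ H → ∀ k : Fin l → ℤ, k ≠ 0 → (∀ i, |(k i : ℝ)| ≤ H) → Real.exp (-(H ^ ε)) ≤ ‖∑ i, (k i : ℂ) * y i‖) → l + d < d * l → ((⌈((d * l : ℕ) : ℚ) / ((l + d : ℕ) : ℚ)⌉₊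 : ℕ) : Cardinal) ≤ Algebra.trdeg ℚ ↥(IntermediateField.adjoin ℚ (Set.range x ∪ Set.range y ∪ Set.range (fun p : Fin d × Fin l => Complex.exp (x p.1 * y p.2))))) → ∀ (h : ℕ) (ω : Fin h → ℂ) (c : ℂ), LinearIndependent ℚ ω → (∀ i j, ω i * ω j ∈ Submodule.span ℚ (Set.range ω)) → c ≠ 0 → 3 ≤ h → (((h + 1) / 2 : ℕ) : Cardinal) ≤ Algebra.trdeg ℚ ↥(IntermediateField.adjoin ℚ (Set.range (fun i => c * ω i) ∪ Set.range (fun i => Complex.exp (c * ω i))))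

/-- item stmt-Schanuel-12143 · support · rank 9 · open · by planner
sources: BakerTNT1975, NesterenkoPhilippon2001
[support] KNOWN END OF CRUX 2: for algebraic slope c ≠ 0 the numbers cωᵢ are algebraic and
ℚ-linearly independent, so e^{cωᵢ} are algebraically independent by Lindemann–Weierstrass (tree
theorem Literature.NumberTheory.Transcendental.linearIndependent_exp_holds /
transcendental_exp_holds, sorry-free) and trdeg ℚ(cω, e^{cω}) ≥ h. (ωᵢ is integral: multiplication
by ωᵢ is an endomorphism of the finite-dimensional span.) [difficulty: provable-now] -/
@[route_item "route-Schanuel-CapacityLadder"]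
def AlgebraicSlopeLines : Prop :=
  ∀ (h : ℕ) (ω : Fin h → ℂ) (c : ℂ), LinearIndependent ℚ ω → (∀ i j, ω i * ω j ∈ Submodule.span ℚ (Set.range ω)) → c ≠ 0 → IsAlgebraic ℚ c → (h : Cardinal) ≤ Algebra.trdeg ℚ ↥(IntermediateField.adjoin ℚ (Set.range (fun i => c * ω i) ∪ Set.range (fun i => Complex.exp (c * ω i))))

/-- item stmt-Schanuel-12144 · support · rank 9 · open · by planner
sources: NesterenkoPhilippon2001, BakerTNT1975
[support] THE LADDER IS BELOW X: X ⇒ SchanuelOnNumberFieldLines (column d = 1, x = (1), y = cω: cω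
is ℚ-independent for c ≠ 0), SchanuelOnNumberFieldLines ⇒ SchanuelOnQuadraticLines (h = 2, ω = (1,
β)), X ⇒ ETowerAlgIndep (y = (1, e, …, e^N), ℚ-independent by transcendence of e — tree theorem
Literature.NumberTheory.Transcendental.transcendental_exp_one_holds; algebraic independence of an
ℕ-family is that of its finite subfamilies). Certifies honestly that every crux is a consequence of
the target. [difficulty: provable-now] -/
@[route_item "route-Schanuel-CapacityLadder"]
def LadderBookkeeping : Prop :=
  (CartesianSchanuelThesis → SchanuelOnNumberFieldLines) ∧ (SchanuelOnNumberFieldLines → SchanuelOnQuadraticLines) ∧ (CartesianSchanuelThesis → ETowerAlgIndep)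

/-- item stmt-Schanuel-10619 · assembly · rank 1 · open · by planner
sources: NesterenkoPhilippon2001, arXiv:math/0312440
[assembly] X → Schanuel, stated BY NAME (was the same implication with the body of
CartesianSchanuelThesis inlined — the glue.extra-hypothesis finding of the 2026-08-15 audit).
Provable now (bookkeeping, any idle prover): specialise d = 1, x = ![1]; the products ![1] p.1 · y
p.2 are y p.2 (reindex along Equiv.uniqueProd : Fin 1 × Fin l ≃ Fin l, so LinearIndependent
transfers by .comp), Set.range ![1] = {1} (Matrix.range_cons_empty) adds nothing to ℚ(y, e^y)
(one_mem + IntermediateField.adjoin_le_iff / adjoin.mono), and ((1 * l : ℕ) : Cardinal) = l —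
exactly the proof the route's deciding theorem `closes` performs (kernel-checked; nothing in the
route waits on this item). Sources: Waldschmidt2000 §1.4;
Literature.Barriers.Schanuel.cartesianSchanuel_of_schanuel (the converse). -/
@[route_item "route-Schanuel-CapacityLadder"]
def Assembly : Prop :=
  CartesianSchanuelThesis → Schanuel

/-! D-0027 §2.1 — DECIDING THEOREM (planner-authored via `route open/edit --closes-file`; by planner-plancard-Schanuel-Schanuel-grid-capac-7f2e3e00-g2-0 2026-08-15T18:50:09Z):
its hypotheses are this route's items and its conclusion the sub-problem Statement (glue_lint), and it elaborates with this file. -/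

/-- D-0027 §2.1 deciding theorem of route CapacityLadder: hypothesis = the route's target item
`CartesianSchanuelThesis` (X, the grid form of Schanuel, shared with route AlgIndepMethod), conclusion = the
sub-problem Statement `Schanuel` BY NAME. Content (kernel-checked, axioms propext / Classical.choice / Quot.sound):
X at `d = 1`, `x = ![1]` IS Schanuel — the products `1 · zⱼ` are the `zⱼ` (reindex along
`Equiv.uniqueProd (Fin n) (Fin 1) : Fin 1 × Fin n ≃ Fin n`), `Set.range ![1] = {1}` adds nothing to `ℚ(z, e^z)`
(`one_mem`), and `(1 * n : ℕ) = n`. The ranked cruxes (SchanuelOnNumberFieldLines, SchanuelOnQuadraticLines,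
ETowerAlgIndep) are rungs strictly BELOW X (ladder route: `LadderBookkeeping` records X ⇒ each of them) and the
calibration supports are theorems about the method, so none of them is a hypothesis of `closes`. -/
@[closes "route-Schanuel-CapacityLadder"] theorem closes (hX : CartesianSchanuelThesis) : _root_.Schanuel := by
  intro n z hz
  -- the `d = 1`, `x = ![1]` instance of the Cartesian thesis: the products `![1] p.1 * z p.2` are `z p.2`
  have hli : LinearIndependent ℚ (fun p : Fin 1 × Fin n => (![(1 : ℂ)] : Fin 1 → ℂ) p.1 * z p.2) := by
    have h1 : (fun p : Fin 1 × Fin n => (![(1 : ℂ)] : Fin 1 → ℂ) p.1 * z p.2)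
        = z ∘ (Equiv.uniqueProd (Fin n) (Fin 1)) := by
      funext p; simp
    rw [h1]
    exact hz.comp _ (Equiv.injective _)
  -- `{1} ∪ range z ∪ range (e^z ∘ snd)` generates the same intermediate field as `range z ∪ range (e^z)`
  have hE : IntermediateField.adjoin ℚ (Set.range (![(1 : ℂ)] : Fin 1 → ℂ) ∪ Set.range z ∪
        Set.range (fun p : Fin 1 × Fin n => Complex.exp ((![(1 : ℂ)] : Fin 1 → ℂ) p.1 * z p.2)))
      = IntermediateField.adjoin ℚ (Set.range z ∪ Set.range (Complex.exp ∘ z)) := by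
    have hr1 : Set.range (![(1 : ℂ)] : Fin 1 → ℂ) = {1} := by
      rw [Matrix.range_cons_empty]
    have hr2 : Set.range (fun p : Fin 1 × Fin n => Complex.exp ((![(1 : ℂ)] : Fin 1 → ℂ) p.1 * z p.2))
        = Set.range (Complex.exp ∘ z) := by
      have h2 : (fun p : Fin 1 × Fin n => Complex.exp ((![(1 : ℂ)] : Fin 1 → ℂ) p.1 * z p.2))
          = (Complex.exp ∘ z) ∘ (Prod.snd : Fin 1 × Fin n → Fin n) := by
        funext p; simp
      rw [h2, Prod.snd_surjective.range_comp]
    rw [hr1, hr2]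
    apply le_antisymm
    · rw [IntermediateField.adjoin_le_iff]
      rintro t ((rfl | ht) | ht)
      · exact one_mem _
      · exact IntermediateField.subset_adjoin ℚ _ (Or.inl ht)
      · exact IntermediateField.subset_adjoin ℚ _ (Or.inr ht)
    · apply IntermediateField.adjoin.mono
      rintro t (ht | ht)
      · exact Or.inl (Or.inr ht)
      · exact Or.inr ht
  calc (n : Cardinal) = ((1 * n : ℕ) : Cardinal) := by simp
    _ ≤ Algebra.trdeg ℚ ↥(IntermediateField.adjoin ℚ (Set.range (![(1 : ℂ)] : Fin 1 → ℂ) ∪ Set.range z ∪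
          Set.range (fun p : Fin 1 × Fin n => Complex.exp ((![(1 : ℂ)] : Fin 1 → ℂ) p.1 * z p.2)))) :=
        hX 1 n ![1] z hli
    _ = Algebra.trdeg ℚ ↥(IntermediateField.adjoin ℚ (Set.range z ∪ Set.range (Complex.exp ∘ z))) := by
        rw [hE]

end Summit.Schanuel.Schanuel.Theses.CapacityLadder
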